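import Summits.QuantumFields.BalabanUV.T4Continuum.Support.NE7ApeFlatSkeletonLocalised
import HarnessLib

/-!
# NE7ApeFlatSkeletonTestClass — TORUS ROAD v4 SKELETON: F252's localised flat bootstrap with the TEST CLASS as a PARAMETER `T` (the letters (R⊥), the localised
# solver letter's premise and the criticality defect are asked on skew periodic `Y` with `T Y`); F252 is `T Y := (dirIter L (k+1) F̃ Y = 0)` (flat-tangent), and the
# torus road's natural class is `T Y := ((Qcoarse L)^[k+1] Y = 0)` (STRAIGHT-tangent) — the class on which the criticality pairing of the cut-off representative is small

Cell `pub-balaban`, rung (B)+1 sub-cell t4, lineage `b2b-balaban-t4-ne7-p1` (CRUX PROVER NE7 #1 = OWNER of row NE7), generation 89; memo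
`t4/b2b-balaban-t4-ne7-p1-g89/COSTING-N1.md` §7 (the straight-tangent test class).  File F260 (over F252 `NE7ApeFlatSkeletonLocalised` — its §1∕§2 proofs are parametric
in the test predicate; this file records that).

WHY (memo §7).  The defect letter of the torus road pairs `dAction U′(χ′Y)` through the criticality of `U′ = U^u`; after absorbing the frame term by an exact gauge
direction of `U′` (F244's identity, any top) the pairing costs `c_R‖Q̄_{U′}(χ′Y)‖₁`, which splits into a background-locality term, F51's Lipschitz term `O(α̂)`, and
`Q̄_1(χ′Y)` — small only when `Q̄_1Y = 0`, i.e. for STRAIGHT-tangent tests (`(Qcoarse L)^[k+1] Y = 0`), not for flat-tangent ones (`D_1Y = 0` leaves the frame term; F53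
needed the flat top to absorb it).  On straight-tangent tests (R⊥♭) holds DIRECTLY (lit-balaban's `curl_HkOp_orthogonal` with `Q_k a = 0`) and the G♭ transfer needs NO
tangent corrector (the test directions `Y^{a}` are straight-tangent: `Qcoarse_iterate_test_eq_zero`).  Hence the skeleton is re-issued with the test class abstract; the
v4 END instantiates `T :=` straight-tangent once (R⊥♭)-straight and G♭-loc-straight are in the tree (successor files).
WHAT ([folklore] composition; 0 def, 0 sorry).  **`norm_plaq_vary_sub_one_le_of_localisedLetters_test`**, **`norm_plaq_sub_one_le_of_localisedLetters_gauge_test`** —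
F252 §1∕§2 with `T : (Site d → Fin d → Matrix n n ℂ) → Prop` in place of flat-tangency in the three test-quantified letters.
HONEST FRAMING (page 1): composition over HYPOTHESES; nothing of Bałaban's asserted; NOT (APE), NOT ONE-STEP, NOT NE7; spine 0∕9; finite T⁴ rung (B)+1 — NOT infinite
volume, NOT mass gap, NOT `BetaPertH`, NOT Clay.  Continuum YM on T⁴ ⇐ BetaPertH ∧ nine spine estimates (0/9 proved); BetaPertH ⇐ (D1) ∧ (D4) ∧ CAP+tail; G-an2-4
gates asym, D1 and NE2/3/4.
-/

set_option autoImplicit false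

open scoped BigOperators Matrix.Norms.L2Operator
open NormedSpace Finset Set

namespace Summit.QuantumFields.BalabanUV.T4Continuum.NE7ApeFlatSkeletonTestClass

open Literature.MathematicalPhysics.QuantumFieldTheory.Balaban1983to89
open B7Prop1Explicit B7Prop2Explicit MatrixLog UnitaryModel
open T4AveragingDeficitWall (IsUnitaryCfg IsSkewDir SmallField vary curlAt dirL1)
open T4AveragingDeficitWallBoundary (IsPeriodicCfg periodBox)
open AveragingDeficitPeriodicCounting (IsPeriodicDir)
open AveragingDeficitMultiLevelPrep (LevelSmall)
open MinimalActionLevels (perWin)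
open NE3HessForm (hess dAction)
open NE3TangentCovariantTower (dirIter)
open NE3ResidualSliceRep (dirIter_sub)
open NE3EnergyHessBilin (hess_add_left)
open NE3EnergyShapes (IsUnitarySite)
open NE7ApeFlatSkeleton (norm_hol_vary_flat_sub_one_le curlAt_eq_add_of_split)
open NE7ApeFlatSkeletonLocal (hol_plaqWord_congr)
open NE7ApeOfLocalChartLetter (norm_plaq_sub_one_le_gaugeAct)

noncomputable section

variable {d : ℕ} {n : Type*} [Fintype n] [DecidableEq n]

/-! ## §1 The flat bootstrap with two-region densities, a localised solver letter, and an ARBITRARY test class -/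

/-- **THE FLAT BOOTSTRAP, LOCALISED FORM** (F245 §1 with two-region densities): for `Ũ = F̃e^{A}` (letters as in F245: `F̃` flat, `A` skew periodic with
`‖A‖ ≤ α₀`, the normal part `A_N` skew periodic EXACT and NORTH, the slice `S ∋ A − A_N`), if at the plaquette `(z; μ ≠ ν)` the slice solver letter holds in the
LOCALISED form `hGloc` (sources `≤ a‖Y‖_{1,Bn} + b‖Y‖_{1,Bf}` on skew periodic flat tangents give `‖curlAt F̃ X z μ ν‖ ≤ K_G(a + ϵb)`), the expansion letter holds
with densities `(ρn, ρf)` and the criticality defect with `(τn, τf)` on the two regions, then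
`‖Ũ(∂p_{μν}(z)) − 1‖ ≤ K_G((τn + ρn) + ϵ(τf + ρf)) + ‖curlAt F̃ A_N z μ ν‖ + 28α₀²`. [folklore] -/
theorem norm_plaq_vary_sub_one_le_of_localisedLetters_test [Nonempty n] {L : ℕ} (hL : 1 ≤ L) (k : ℕ) {P : ℕ}
    {Ft : Site d → Fin d → (Matrix n n ℂ)ˣ} (hFt : IsUnitaryCfg Ft) (hFt0 : SmallField Ft 0)
    {x : ℝ} (hx : 0 ≤ x) (hs : LevelSmall d L k x) (hFtx : SmallField Ft x)
    (T : (Site d → Fin d → Matrix n n ℂ) → Prop)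
    {A : Site d → Fin d → Matrix n n ℂ} (hA : IsSkewDir A) (hAP : IsPeriodicDir A (P : ℤ)) {α₀ : ℝ} (hAα : ∀ y μ, ‖A y μ‖ ≤ α₀)
    -- the normal part: exactness and (R⊥) output
    {AN : Site d → Fin d → Matrix n n ℂ} (hNs : IsSkewDir AN) (hNP : IsPeriodicDir AN (P : ℤ))
    (hNexact : dirIter L (k + 1) Ft AN = dirIter L (k + 1) Ft A)
    (hNorth : ∀ Y : Site d → Fin d → Matrix n n ℂ, IsSkewDir Y → IsPeriodicDir Y (P : ℤ) → T Y →
      hess Ft AN Y (perWin d P) = 0)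
    -- the gauge slice, the two regions, and the LOCALISED slice solver letter at the plaquette
    (S : Set (Site d → Fin d → Matrix n n ℂ)) (hTS : (fun y μ => A y μ - AN y μ) ∈ S)
    (Bn Bf : Finset (Site d)) {ϵ KG : ℝ} (z : Site d) {μ ν : Fin d} (hμν : μ ≠ ν)
    (hGloc : ∀ X ∈ S, IsSkewDir X → IsPeriodicDir X (P : ℤ) → dirIter L (k + 1) Ft X = 0 → ∀ a b : ℝ, 0 ≤ a → 0 ≤ b →
      (∀ Y : Site d → Fin d → Matrix n n ℂ, IsSkewDir Y → IsPeriodicDir Y (P : ℤ) → T Y →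
        |hess Ft X Y (perWin d P)| ≤ a * dirL1 Y Bn + b * dirL1 Y Bf) →
      ‖curlAt Ft X z μ ν‖ ≤ KG * (a + ϵ * b))
    -- the expansion letter, two-region
    {ρn ρf : ℝ} (hρn : 0 ≤ ρn) (hρf : 0 ≤ ρf)
    (hEXP : ∀ Y : Site d → Fin d → Matrix n n ℂ, IsSkewDir Y → IsPeriodicDir Y (P : ℤ) →
      |dAction (vary Ft A 1) Y (perWin d P) - hess Ft A Y (perWin d P)| ≤ ρn * dirL1 Y Bn + ρf * dirL1 Y Bf)
    -- criticality of the representative UP TO A TWO-REGION DEFECT, tested against FLAT-tangent directions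
    {τn τf : ℝ} (hτn : 0 ≤ τn) (hτf : 0 ≤ τf)
    (hcritD : ∀ Y : Site d → Fin d → Matrix n n ℂ, IsSkewDir Y → IsPeriodicDir Y (P : ℤ) → T Y →
      |dAction (vary Ft A 1) Y (perWin d P)| ≤ τn * dirL1 Y Bn + τf * dirL1 Y Bf) :
    ‖((hol (vary Ft A 1) z (plaqWord μ ν) : (Matrix n n ℂ)ˣ) : Matrix n n ℂ) - 1‖
      ≤ KG * ((τn + ρn) + ϵ * (τf + ρf)) + ‖curlAt Ft AN z μ ν‖ + 28 * α₀ ^ 2 := by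
  -- the tangent part
  set X : Site d → Fin d → Matrix n n ℂ := fun y μ => A y μ - AN y μ with hXdef
  have hXs : IsSkewDir X := fun y μ => (skewAdjoint (Matrix n n ℂ)).sub_mem (hA y μ) (hNs y μ)
  have hXP : IsPeriodicDir X (P : ℤ) := fun y i μ => by simp only [hXdef, hAP y i μ, hNP y i μ]
  have hXT : dirIter L (k + 1) Ft X = 0 := by
    rw [hXdef, dirIter_sub hL k hFt hx hs hFtx A AN, hNexact]
    funext z κ
    simp
  -- the two-region source density on the tangent space
  have hsrc : ∀ Y : Site d → Fin d → Matrix n n ℂ, IsSkewDir Y → IsPeriodicDir Y (P : ℤ) → T Y →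
      |hess Ft X Y (perWin d P)| ≤ (τn + ρn) * dirL1 Y Bn + (τf + ρf) * dirL1 Y Bf := by
    intro Y hY hYP hYT
    have hsplitA : A = X + AN := by funext y μ; simp [hXdef]
    have hhess : hess Ft X Y (perWin d P) = hess Ft A Y (perWin d P) := by
      have h := hess_add_left Ft (perWin d P) X AN Y
      rw [← hsplitA, hNorth Y hY hYP hYT, add_zero] at h
      exact h.symm
    have hdA := hcritD Y hY hYP hYT
    have hE := hEXP Y hY hYP
    have htri : |hess Ft A Y (perWin d P)| ≤ |dAction (vary Ft A 1) Y (perWin d P)|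
        + |dAction (vary Ft A 1) Y (perWin d P) - hess Ft A Y (perWin d P)| := by
      have := abs_sub_abs_le_abs_sub (hess Ft A Y (perWin d P)) (dAction (vary Ft A 1) Y (perWin d P))
      rw [abs_sub_comm] at this
      linarith
    rw [hhess]
    calc |hess Ft A Y (perWin d P)|
        ≤ (τn * dirL1 Y Bn + τf * dirL1 Y Bf) + (ρn * dirL1 Y Bn + ρf * dirL1 Y Bf) := by linarith
      _ = (τn + ρn) * dirL1 Y Bn + (τf + ρf) * dirL1 Y Bf := by ring
  -- the localised slice solver bounds the tangent part's curl AT THE PLAQUETTE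
  have hXz : ‖curlAt Ft X z μ ν‖ ≤ KG * ((τn + ρn) + ϵ * (τf + ρf)) :=
    hGloc X hTS hXs hXP hXT (τn + ρn) (τf + ρf) (add_nonneg hτn hρn) (add_nonneg hτf hρf) hsrc
  -- the curl of `A` at the given plaquette
  have hsplit : ∀ y κ, A y κ = X y κ + AN y κ := fun y κ => by simp [hXdef]
  have hsplitz : curlAt Ft A z μ ν = curlAt Ft X z μ ν + curlAt Ft AN z μ ν := curlAt_eq_add_of_split Ft hsplit z μ ν
  have hnorm : ‖curlAt Ft X z μ ν + curlAt Ft AN z μ ν‖ ≤ ‖curlAt Ft X z μ ν‖ + ‖curlAt Ft AN z μ ν‖ := norm_add_le _ _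
  have hcurlA : ‖curlAt Ft A z μ ν‖ ≤ KG * ((τn + ρn) + ϵ * (τf + ρf)) + ‖curlAt Ft AN z μ ν‖ := by
    rw [hsplitz]; linarith
  have h := norm_hol_vary_flat_sub_one_le hFt hFt0 hA hAα z hμν
  linarith

/-! ## §2 Through a matching gauge -/

/-- **THE SAME BOUND FOR `U` THROUGH A UNITARY GAUGE MATCHING `Ũ = F̃e^{A}` ON THE FOUR BONDS OF THE PLAQUETTE** (F245 §2 with §1's localised letters).
[folklore] -/
theorem norm_plaq_sub_one_le_of_localisedLetters_gauge_test [Nonempty n] {L : ℕ} (hL : 1 ≤ L) (k : ℕ) {P : ℕ}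
    {Ft : Site d → Fin d → (Matrix n n ℂ)ˣ} (hFt : IsUnitaryCfg Ft) (hFt0 : SmallField Ft 0)
    {x : ℝ} (hx : 0 ≤ x) (hs : LevelSmall d L k x) (hFtx : SmallField Ft x)
    (T : (Site d → Fin d → Matrix n n ℂ) → Prop)
    {A : Site d → Fin d → Matrix n n ℂ} (hA : IsSkewDir A) (hAP : IsPeriodicDir A (P : ℤ)) {α₀ : ℝ} (hAα : ∀ y μ, ‖A y μ‖ ≤ α₀)
    {AN : Site d → Fin d → Matrix n n ℂ} (hNs : IsSkewDir AN) (hNP : IsPeriodicDir AN (P : ℤ))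
    (hNexact : dirIter L (k + 1) Ft AN = dirIter L (k + 1) Ft A)
    (hNorth : ∀ Y : Site d → Fin d → Matrix n n ℂ, IsSkewDir Y → IsPeriodicDir Y (P : ℤ) → T Y →
      hess Ft AN Y (perWin d P) = 0)
    (S : Set (Site d → Fin d → Matrix n n ℂ)) (hTS : (fun y μ => A y μ - AN y μ) ∈ S)
    (Bn Bf : Finset (Site d)) {ϵ KG : ℝ} (z : Site d) {μ ν : Fin d} (hμν : μ ≠ ν)
    (hGloc : ∀ X ∈ S, IsSkewDir X → IsPeriodicDir X (P : ℤ) → dirIter L (k + 1) Ft X = 0 → ∀ a b : ℝ, 0 ≤ a → 0 ≤ b →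
      (∀ Y : Site d → Fin d → Matrix n n ℂ, IsSkewDir Y → IsPeriodicDir Y (P : ℤ) → T Y →
        |hess Ft X Y (perWin d P)| ≤ a * dirL1 Y Bn + b * dirL1 Y Bf) →
      ‖curlAt Ft X z μ ν‖ ≤ KG * (a + ϵ * b))
    {ρn ρf : ℝ} (hρn : 0 ≤ ρn) (hρf : 0 ≤ ρf)
    (hEXP : ∀ Y : Site d → Fin d → Matrix n n ℂ, IsSkewDir Y → IsPeriodicDir Y (P : ℤ) →
      |dAction (vary Ft A 1) Y (perWin d P) - hess Ft A Y (perWin d P)| ≤ ρn * dirL1 Y Bn + ρf * dirL1 Y Bf)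
    {τn τf : ℝ} (hτn : 0 ≤ τn) (hτf : 0 ≤ τf)
    (hcritD : ∀ Y : Site d → Fin d → Matrix n n ℂ, IsSkewDir Y → IsPeriodicDir Y (P : ℤ) → T Y →
      |dAction (vary Ft A 1) Y (perWin d P)| ≤ τn * dirL1 Y Bn + τf * dirL1 Y Bf)
    -- the configuration of interest and a gauge matching the representative on the plaquette
    {U : Site d → Fin d → (Matrix n n ℂ)ˣ} {u : Site d → (Matrix n n ℂ)ˣ} (hu : IsUnitarySite u)
    (h1 : gaugeAct u U z μ = vary Ft A 1 z μ) (h2 : gaugeAct u U (z + e μ) ν = vary Ft A 1 (z + e μ) ν)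
    (h3 : gaugeAct u U (z + e ν) μ = vary Ft A 1 (z + e ν) μ) (h4 : gaugeAct u U z ν = vary Ft A 1 z ν) :
    ‖((hol U z (plaqWord μ ν) : (Matrix n n ℂ)ˣ) : Matrix n n ℂ) - 1‖
      ≤ KG * ((τn + ρn) + ϵ * (τf + ρf)) + ‖curlAt Ft AN z μ ν‖ + 28 * α₀ ^ 2 := by
  have hrep := norm_plaq_vary_sub_one_le_of_localisedLetters_test hL k hFt hFt0 hx hs hFtx T hA hAP hAα hNs hNP hNexact hNorth S hTS Bn Bf z hμν hGloc
    hρn hρf hEXP hτn hτf hcritD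
  have hg := norm_plaq_sub_one_le_gaugeAct (U := U) hu z μ ν
  rw [hol_plaqWord_congr h1 h2 h3 h4] at hg
  exact hg.trans hrep

end

end Summit.QuantumFields.BalabanUV.T4Continuum.NE7ApeFlatSkeletonTestClass
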